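import Mathlib.Algebra.Order.Ring.Basic
import Mathlib.Analysis.PSeries
import Literature.Analysis.FunctionSpaces.TorusFourierModes
import Literature.Analysis.FunctionSpaces.TorusVectorParseval

/-!
# Two uniform frequency sums: Sobolev weights of a smooth force, and a convergent lattice sum

Helper file for stub S5 (`stub_balancedMenu`) of the line `farkas-split-menu` of crux
`MomentParity.CubicParityLoud` (stmt-AnomalousDissipation-11465). The stress packets of the balanced
menu cost, at momentum `q`, an enstrophy `≲ (1+|q|²)⁻³ + (1+|q|²)⁵ ‖f̂(q)‖²`; summed over the
punctured ball this must stay bounded UNIFORMLY in the truncation level. Recorded here: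

* `exists_sum_weight_mul_norm_sq_mFourierCoeff_le` — for a smooth `f : T³ → ℝ³` there is `C` with
  `∑_{q∈T} (1+|q|²)⁶ ‖f̂(q)‖² ≤ C` for EVERY finite `T` (Bessel's inequality for `f` and `Δ³f`,
  `(Δ³f)^(q) = (-4π²|q|²)³ f̂(q)`, and `(1+x)⁶ ≤ 2⁵(1+x⁶)`);
* `exists_sum_inv_weight_cube_le` — there is `L` with `∑_{q∈T} (1+|q|²)⁻³ ≤ L` for every finite
  `T ⊂ ℤ³` (`(1+|q|²)³ ≥ ∏ⱼ (1+qⱼ²)` and `∑_{n∈ℤ} (1+n²)⁻¹ < ∞`).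
-/

noncomputable section

namespace Summit.AnomalousDissipation.AnomalousDissipation.Theorems.MomentParityCubicParityLoud

open MeasureTheory Finset UnitAddTorus
open Literature.Analysis.FunctionSpaces

set_option linter.dupNamespace false

/-! ## Sobolev weights of a smooth force -/

section Sobolev

/-- **Bessel's inequality for a square-integrable vector field on `T³`**: every finite sum of
`‖f̂(q)‖²` is at most `∫ ‖f‖²`. [folklore] -/
theorem sum_norm_sq_mFourierCoeff_le {f : UnitAddTorus (Fin 3) → EuclideanSpace ℝ (Fin 3)}
    (hf : MemLp f 2 volume) (T : Finset (Fin 3 → ℤ)) :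
    ∑ q ∈ T, ‖mFourierCoeff (EuclideanSpace.complexify ∘ f) q‖ ^ 2 ≤ ∫ x, ‖f x‖ ^ 2 :=
  sum_le_hasSum T (fun _ _ => sq_nonneg _) (Torus.hasSum_sq_norm_mFourierCoeff_complexify hf)

/-- Fourier coefficients of the triple Laplacian: `(Δ³f)^(q) = (-4π²|q|²)³ f̂(q)`. [folklore] -/
theorem mFourierCoeff_laplacian_three {f : UnitAddTorus (Fin 3) → EuclideanSpace ℝ (Fin 3)}
    (hf : Torus.IsSmooth f) (q : Fin 3 → ℤ) :
    mFourierCoeff (EuclideanSpace.complexify ∘ Torus.laplacian (Torus.laplacian (Torus.laplacian f))) q =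
      (-(((4 * Real.pi ^ 2 * Torus.freqNormSq q : ℝ) : ℂ))) ^ 3 •
        mFourierCoeff (EuclideanSpace.complexify ∘ f) q := by
  rw [Torus.mFourierCoeff_complexify_laplacian hf.laplacian.laplacian,
    Torus.mFourierCoeff_complexify_laplacian hf.laplacian, Torus.mFourierCoeff_complexify_laplacian hf]
  simp only [smul_neg, smul_smul, neg_neg]
  rw [← neg_smul]
  congr 1
  ring

/-- `(1 + x)⁶ ≤ 32 (1 + x⁶)` for `x ≥ 0`. [folklore] -/
theorem one_add_pow_six_le {x : ℝ} (hx : 0 ≤ x) : (1 + x) ^ 6 ≤ 32 * (1 + x ^ 6) := by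
  have h := add_pow_le zero_le_one hx 6
  norm_num at h
  linarith

/-- **Uniform Sobolev-weight bound for a smooth force**: for smooth `f : T³ → ℝ³` there is a constant
`C ≥ 0` with `∑_{q∈T} (1+|q|²)⁶ ‖f̂(q)‖² ≤ C` for every finite set of frequencies `T`. [folklore] -/
theorem exists_sum_weight_mul_norm_sq_mFourierCoeff_le {f : UnitAddTorus (Fin 3) → EuclideanSpace ℝ (Fin 3)}
    (hf : Torus.IsSmooth f) :
    ∃ C : ℝ, 0 ≤ C ∧ ∀ T : Finset (Fin 3 → ℤ),
      ∑ q ∈ T, (1 + Torus.freqNormSq q) ^ 6 * ‖mFourierCoeff (EuclideanSpace.complexify ∘ f) q‖ ^ 2 ≤ C := by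
  set g := Torus.laplacian (Torus.laplacian (Torus.laplacian f)) with hg_def
  have hg : Torus.IsSmooth g := hf.laplacian.laplacian.laplacian
  set If : ℝ := ∫ x, ‖f x‖ ^ 2 with hIf
  set Ig : ℝ := ∫ x, ‖g x‖ ^ 2 with hIg
  have hIf0 : 0 ≤ If := integral_nonneg fun x => sq_nonneg _
  have hIg0 : 0 ≤ Ig := integral_nonneg fun x => sq_nonneg _
  have hπ : 0 < (4 * Real.pi ^ 2) ^ 6 := by positivity
  refine ⟨32 * (If + Ig / (4 * Real.pi ^ 2) ^ 6),
    mul_nonneg (by norm_num) (add_nonneg hIf0 (div_nonneg hIg0 hπ.le)), fun T => ?_⟩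
  have hBf := sum_norm_sq_mFourierCoeff_le (hf.memLp 2) T
  have hBg := sum_norm_sq_mFourierCoeff_le (hg.memLp 2) T
  -- `‖ĝ(q)‖² = (4π²|q|²)⁶ ‖f̂(q)‖²`
  have hgq : ∀ q, ‖mFourierCoeff (EuclideanSpace.complexify ∘ g) q‖ ^ 2 =
      (4 * Real.pi ^ 2) ^ 6 * (Torus.freqNormSq q ^ 6 * ‖mFourierCoeff (EuclideanSpace.complexify ∘ f) q‖ ^ 2) := by
    intro q
    rw [hg_def, mFourierCoeff_laplacian_three hf, norm_smul, norm_pow, norm_neg, Complex.norm_real,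
      Real.norm_of_nonneg (mul_nonneg (by positivity) (Torus.freqNormSq_nonneg q))]
    ring
  -- termwise weight bound
  have hterm : ∀ q, (1 + Torus.freqNormSq q) ^ 6 * ‖mFourierCoeff (EuclideanSpace.complexify ∘ f) q‖ ^ 2 ≤
      32 * (‖mFourierCoeff (EuclideanSpace.complexify ∘ f) q‖ ^ 2 +
        ‖mFourierCoeff (EuclideanSpace.complexify ∘ g) q‖ ^ 2 / (4 * Real.pi ^ 2) ^ 6) := by
    intro q
    rw [hgq, mul_div_cancel_left₀ _ hπ.ne']
    have h1 := one_add_pow_six_le (Torus.freqNormSq_nonneg q)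
    have h2 : 0 ≤ ‖mFourierCoeff (EuclideanSpace.complexify ∘ f) q‖ ^ 2 := sq_nonneg _
    nlinarith
  calc ∑ q ∈ T, (1 + Torus.freqNormSq q) ^ 6 * ‖mFourierCoeff (EuclideanSpace.complexify ∘ f) q‖ ^ 2
      ≤ ∑ q ∈ T, 32 * (‖mFourierCoeff (EuclideanSpace.complexify ∘ f) q‖ ^ 2 +
          ‖mFourierCoeff (EuclideanSpace.complexify ∘ g) q‖ ^ 2 / (4 * Real.pi ^ 2) ^ 6) :=
        Finset.sum_le_sum fun q _ => hterm q
    _ = 32 * (∑ q ∈ T, ‖mFourierCoeff (EuclideanSpace.complexify ∘ f) q‖ ^ 2 +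
          (∑ q ∈ T, ‖mFourierCoeff (EuclideanSpace.complexify ∘ g) q‖ ^ 2) / (4 * Real.pi ^ 2) ^ 6) := by
        rw [← Finset.mul_sum, Finset.sum_add_distrib, Finset.sum_div]
    _ ≤ 32 * (If + Ig / (4 * Real.pi ^ 2) ^ 6) := by gcongr

end Sobolev

/-! ## A convergent lattice sum -/

section Lattice

/-- `(1 + |q|²)³ ≥ ∏ⱼ (1 + qⱼ²)` for `q ∈ ℤ³`. [folklore] -/
theorem prod_one_add_sq_le (q : Fin 3 → ℤ) :
    ∏ j, (1 + ((q j : ℤ) : ℝ) ^ 2) ≤ (1 + Torus.freqNormSq q) ^ 3 := by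
  rw [Fin.prod_univ_three, Torus.freqNormSq, Fin.sum_univ_three]
  have key : ∀ a b c : ℝ, 0 ≤ a → 0 ≤ b → 0 ≤ c → (1 + a) * (1 + b) * (1 + c) ≤ (1 + (a + b + c)) ^ 3 := by
    intro a b c ha hb hc
    nlinarith [mul_nonneg ha hb, mul_nonneg hb hc, mul_nonneg ha hc, mul_nonneg (mul_nonneg ha hb) hc,
      sq_nonneg (a + b + c), sq_nonneg (a - b), sq_nonneg (b - c), sq_nonneg (a - c)]
  exact key _ _ _ (sq_nonneg _) (sq_nonneg _) (sq_nonneg _)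

/-- `∑_{n∈ℤ} (1+n²)⁻¹` converges. [folklore] -/
theorem summable_inv_one_add_sq : Summable fun n : ℤ => (1 + ((n : ℤ) : ℝ) ^ 2)⁻¹ := by
  have h1 : Summable fun n : ℤ => 1 / ((n : ℤ) : ℝ) ^ 2 := Real.summable_one_div_int_pow.2 one_lt_two
  have h2 : Summable fun n : ℤ => (if n = 0 then (1 : ℝ) else 0) := (hasSum_ite_eq (0 : ℤ) (1 : ℝ)).summable
  refine Summable.of_nonneg_of_le (fun n => by positivity) (fun n => ?_) (h1.add h2)
  by_cases hn : n = 0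
  · subst hn; simp
  · rw [if_neg hn, add_zero, one_div]
    have : (0 : ℝ) < ((n : ℤ) : ℝ) ^ 2 := by positivity
    exact inv_anti₀ this (by linarith)

/-- **Uniform bound for the lattice sum `∑ (1+|q|²)⁻³`** over finite subsets of `ℤ³`. [folklore] -/
theorem exists_sum_inv_weight_cube_le :
    ∃ L : ℝ, 0 ≤ L ∧ ∀ T : Finset (Fin 3 → ℤ), ∑ q ∈ T, ((1 + Torus.freqNormSq q) ^ 3)⁻¹ ≤ L := by
  set Φ : ℝ := ∑' n : ℤ, (1 + ((n : ℤ) : ℝ) ^ 2)⁻¹ with hΦ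
  have hΦ0 : 0 ≤ Φ := tsum_nonneg fun n => by positivity
  refine ⟨Φ ^ 3, by positivity, fun T => ?_⟩
  -- a box containing `T`
  set M : ℕ := T.sup fun q => Finset.univ.sup fun j => (q j).natAbs with hM
  have hbox : T ⊆ Fintype.piFinset fun _ : Fin 3 => Finset.Icc (-(M : ℤ)) M := by
    intro q hq
    rw [Fintype.mem_piFinset]
    intro j
    have h1 : (q j).natAbs ≤ M :=
      le_trans (Finset.le_sup (f := fun j => (q j).natAbs) (Finset.mem_univ j))
        (Finset.le_sup (f := fun q => Finset.univ.sup fun j => (q j).natAbs) hq)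
    rw [Finset.mem_Icc]
    omega
  calc ∑ q ∈ T, ((1 + Torus.freqNormSq q) ^ 3)⁻¹
      ≤ ∑ q ∈ T, ∏ j, (1 + ((q j : ℤ) : ℝ) ^ 2)⁻¹ := by
        refine Finset.sum_le_sum fun q _ => ?_
        rw [Finset.prod_inv_distrib]
        exact inv_anti₀ (Finset.prod_pos fun j _ => by positivity) (prod_one_add_sq_le q)
    _ ≤ ∑ q ∈ Fintype.piFinset (fun _ : Fin 3 => Finset.Icc (-(M : ℤ)) M), ∏ j, (1 + ((q j : ℤ) : ℝ) ^ 2)⁻¹ :=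
        Finset.sum_le_sum_of_subset_of_nonneg hbox fun q _ _ => Finset.prod_nonneg fun j _ => by positivity
    _ = ∏ _j : Fin 3, ∑ n ∈ Finset.Icc (-(M : ℤ)) M, (1 + ((n : ℤ) : ℝ) ^ 2)⁻¹ :=
        Finset.sum_prod_piFinset _ fun (_ : Fin 3) (n : ℤ) => (1 + ((n : ℤ) : ℝ) ^ 2)⁻¹
    _ ≤ ∏ _j : Fin 3, Φ := by
        refine Finset.prod_le_prod (fun j _ => Finset.sum_nonneg fun n _ => by positivity) fun j _ => ?_
        exact summable_inv_one_add_sq.sum_le_tsum _ fun n _ => by positivity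
    _ = Φ ^ 3 := by rw [Finset.prod_const, Finset.card_univ, Fintype.card_fin]

end Lattice

/-- **Registered sub-goal `balancedMenu_sobolevWeights` of stub S5 `stub_balancedMenu`** (summary of
this file): a uniform Sobolev-weight bound for the Fourier coefficients of a smooth force. [folklore] -/
theorem balancedMenu_sobolevWeights : ∀ f : UnitAddTorus (Fin 3) → EuclideanSpace ℝ (Fin 3), Torus.IsSmooth f → ∃ C : ℝ, 0 ≤ C ∧ ∀ T : Finset (Fin 3 → ℤ), ∑ q ∈ T, (1 + Torus.freqNormSq q) ^ 6 * ‖UnitAddTorus.mFourierCoeff (EuclideanSpace.complexify ∘ f) q‖ ^ 2 ≤ C :=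
  fun _ hf => exists_sum_weight_mul_norm_sq_mFourierCoeff_le hf

end Summit.AnomalousDissipation.AnomalousDissipation.Theorems.MomentParityCubicParityLoud

end
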